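import Summits.HodgeConjecture.HodgeConjecture.Theorems.HeckePrymWeilHeckePrymAnchorsWeilSurface
import Literature.AlgebraicGeometry.HodgeTheory.WeilClassesFourfoldsProofs
import Literature.AlgebraicGeometry.HodgeTheory.AbelianVarietyEndomorphismsHOne
import Literature.AlgebraicGeometry.HodgeTheory.GysinBaseChange
import Literature.AlgebraicGeometry.HodgeTheory.ArapuraSurfaceFibredFourfoldsProofs
import Literature.AlgebraicGeometry.HodgeTheory.HypersurfaceLefschetz
import HarnessLib

/-!
# Crux `HeckePrymAnchors` (stmt-HodgeConjecture-14496), line `Sketch` · stub A0 `stub_surfaceBase` on the companion surface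

Route `HeckePrymWeil`. Stub A0 of the line asks, for a Weil SURFACE `(B, ψ)` (`dim B = 2`,
`ψ ≫ ψ = -p·𝟙`, a non-zero rational `(1,1)` class in the typed Weil plane), that the tree's STRONG Weil
plane `weilClassesOf B ψ 1 p ⊆ H²(B(ℂ); ℂ)` (`HodgeTheory/WeilClasses`) consist of algebraic classes.
For a general abelian surface this is Lefschetz `(1,1)` (the tree's UNPROVED named fact
`lefschetzOneOne_rational`) plus the `⋀²H¹`-structure of `H²(B(ℂ))`, which the carriers do not have.
This file PROVES it for THE surface the line actually uses — the companion surface of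
`stub_weilSurface` (`…HeckePrymAnchorsWeilSurface`): `B = E × E`, `E = ℂ/(ℤ + iℤ)` (`ws_E`, `ws_B`),
`ψ = ws_ψ p : (x, y) ↦ (-p·y, x)` — for every `p > 0`, with no Lefschetz `(1,1)` input and no new
definition:

* `sb_weilClassesOf_le` — **`weilClassesOf ws_B (ws_ψ p) 1 p ≤ algebraicClasses ws_B.X 1`**;
* `sb_typedWeilPlane_le` — already the single-operator plane `Eig(T, (1+i√p)²) ⊔ Eig(T, (1-i√p)²)`,
  `T = (𝟙 + ψ)^*`, consists of divisor classes;
* `stub_surfaceBase_companion` — A0 in the stub's quantifier shape, specialised to `(ws_B, ws_ψ p)`;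
* `sb_weilSurface_with_base` — `stub_weilSurface` and A0 merged (a Weil surface WITH algebraic strong
  Weil plane exists), the drop-in for reshaping the line.

Proof (van Geemen, LNM 1594, Lemma 5.2; Deligne, LNM 900, proof of Thm. 4.8, on the tree's real
carriers). Let `ω = x₀ ⌣ x₁` be the top class of `E` (`ws_ω`) and `μ = pr₁ + pr₂ : B → E`.
(1) `pr₁^*ω`, `pr₂^*ω`, `μ^*ω` are DIVISOR classes (`sb_Ω_mem`): every class in `H²` of the curve `E` is
algebraic (`algebraicClasses_eq_top_of_eq_zero_or_le`, the class of a point) and `N¹H²` pulls back along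
surjections (`map_mem_algebraicClasses_one_of_surjective`); `pr₁`, `pr₂`, `μ` have the sections `(𝟙, 0)`,
`(0, 𝟙)`, `(𝟙, 0)`. (2) `L = T - (1+p)` maps ALL of `H²(B(ℂ); ℂ)` into any subspace `Q` containing these
three classes (`sb_L_mem`): `f ↦ f^*ω = f^*x₀ ⌣ f^*x₁` is a quadratic form on `Hom(B, E)` (`sb_Ω_lin`,
additivity on `H¹` and bilinearity of `⌣`); by Künneth (`kunnethSpan_complexBetti`) `H²(B)` is spanned
by `pr₁^*b ⌣ pr₂^*w`, `deg b + deg w = 2`; `H⁰(E) = ℂ·1`, `H²(E) = ℂ·ω` (`E(ℂ) ≃ₜ T²`, `ws_Θ`); with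
`(𝟙+ψ) ≫ pr₁ = pr₁ - p·pr₂`, `(𝟙+ψ) ≫ pr₂ = μ` one gets `T(pr₂^*ω) = μ^*ω`,
`T(pr₁^*ω) = (1+p)·pr₁^*ω - p·μ^*ω + (p²+p)·pr₂^*ω` and, basis-free, for `b, w ∈ H¹(E)` with
`b ⌣ w = β·ω`: `L(pr₁^*b ⌣ pr₂^*w) = (1+p)β·pr₁^*ω - pβ·μ^*ω` (`sb_L_cross`, from
`f^*b ⌣ f^*w = β·f^*ω` for `f = pr₁, pr₂, μ`). (3) On `Eig(T, λ)` the map `L` is `(λ - 1 - p)·id`, and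
`((1+i√p)² - 1 - p)((1-i√p)² - 1 - p) = 4p(p+1) ≠ 0`, so both eigenspaces lie in `Q = N¹H²(B)`; finally
`E± ⊆ Eig(T, (1 ± i√p)²)` by testing `weilClassesOf` at `x = y = 1`. In van Geemen's terms: the Weil
plane is `ℂ·u + ℂ·v`, `u = pr₁^*ω - p·pr₂^*ω`, `v = μ^*ω - pr₁^*ω - pr₂^*ω`, two divisor classes.
-/

noncomputable section
-- every declaration of this problem lives in Summit.HodgeConjecture.HodgeConjecture.… (summit = sub-problem)
set_option linter.dupNamespace false

open CategoryTheory AlgebraicGeometry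
open Literature.AlgebraicGeometry Literature.AlgebraicGeometry.Motives Literature.AlgebraicGeometry.HodgeTheory
open Literature.AlgebraicTopology.SingularHomology
open Literature.AlgebraicGeometry.Motives.AbelianVariety (fst snd prodLift prodLift_fst prodLift_snd)

namespace Summit.HodgeConjecture.HodgeConjecture.Theorems.HeckePrymWeilLine

/-! ### `H⁰` and `H²` of the curve `E` are lines (`E(ℂ) ≃ₜ T²`) -/

/-- `Θ ∘ Θ⁻¹ = id` as continuous maps. [cite: SilvermanAEC2009, Prop. VI.3.6 (b)] -/
theorem sb_Θ_comp_symm : (ws_Θ : C(Torus 2, ComplexPoints ws_E.X)).comp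
    (ws_Θ.symm : C(ComplexPoints ws_E.X, Torus 2)) = ContinuousMap.id _ := by
  ext1 P; exact ws_Θ.apply_symm_apply P

/-- **`H²(E(ℂ); ℂ) = ℂ · ω`** (`H²(T²; ℂ)` is the line spanned by `ξ₀ ⌣ ξ₁`). [cite: HatcherAT2002, §3.2 Example 3.16] -/
theorem sb_E_two (z : complexBetti ws_E.X (1 + 1)) : ∃ r : ℂ, z = r • ws_ω := by
  haveI := finite_singularCohomology_torus ℂ 2 2
  have h1 : Module.finrank ℂ (singularCohomology ℂ ℂ (Torus 2) 2) = 1 := by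
    rw [finrank_singularCohomology_torus]; rfl
  obtain ⟨r, hr⟩ := (finrank_eq_one_iff_of_nonzero' (torusTop ℂ 2) (torusTop_ne_zero 2)).mp h1
    (singularCohomology.map ℂ ℂ (ws_Θ : C(Torus 2, ComplexPoints ws_E.X)) (1 + 1) z)
  refine ⟨r, ?_⟩
  have h2 := congrArg (singularCohomology.map ℂ ℂ (ws_Θ.symm : C(ComplexPoints ws_E.X, Torus 2)) (1 + 1)) hr
  rw [map_smul, ← ws_ω_eq, singularCohomology.map_map, sb_Θ_comp_symm, singularCohomology.map_id] at h2
  exact h2.symm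

/-- **`H⁰(E(ℂ); ℂ) = ℂ · 1`** (`b₀(T²) = 1` and `1 ≠ 0`). [cite: HatcherAT2002, §3.2 Example 3.16] -/
theorem sb_E_zero (z : complexBetti ws_E.X 0) : ∃ r : ℂ, z = r • singularCohomology.one ℂ _ := by
  haveI := finite_singularCohomology_torus ℂ 2 0
  have h1 : Module.finrank ℂ (singularCohomology ℂ ℂ (Torus 2) 0) = 1 := by
    rw [finrank_singularCohomology_torus]; rfl
  have h0 : singularCohomology.one ℂ (Torus 2) ≠ 0 := fun h => by
    have h' := pointEval_one (R := ℂ) (Y := Torus 2) (fun _ => 0)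
    rw [h, map_zero] at h'
    exact zero_ne_one h'
  obtain ⟨r, hr⟩ := (finrank_eq_one_iff_of_nonzero' _ h0).mp h1
    (singularCohomology.map ℂ ℂ (ws_Θ : C(Torus 2, ComplexPoints ws_E.X)) 0 z)
  refine ⟨r, ?_⟩
  have h2 := congrArg (singularCohomology.map ℂ ℂ (ws_Θ.symm : C(ComplexPoints ws_E.X, Torus 2)) 0) hr
  rw [map_smul, singularCohomology.map_one, singularCohomology.map_map, sb_Θ_comp_symm,
    singularCohomology.map_id] at h2
  exact h2.symm

/-! ### The quadratic form `f ↦ f^*ω` on `Hom(B, E)` and `T = (𝟙 + ψ)^*` on it -/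

/-- **`(a·pr₁ + b·pr₂)^*ω = (a² - ab)·pr₁^*ω + ab·μ^*ω + (b² - ab)·pr₂^*ω`**, `μ = pr₁ + pr₂`
(`f ↦ f^*ω = f^*x₀ ⌣ f^*x₁` is a quadratic form: additivity on `H¹`, bilinearity of `⌣`).
[cite: vanGeemen1994HodgeAV, Lemma 5.2] -/
theorem sb_Ω_lin (a b : ℤ) :
    complexBetti.map (a • fst ws_E ws_E + b • snd ws_E ws_E).hom.hom.hom (1 + 1) ws_ω =
      ((a : ℂ) ^ 2 - a * b) • complexBetti.map (fst ws_E ws_E).hom.hom.hom (1 + 1) ws_ω +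
        ((a : ℂ) * b) • complexBetti.map (fst ws_E ws_E + snd ws_E ws_E).hom.hom.hom (1 + 1) ws_ω +
        ((b : ℂ) ^ 2 - a * b) • complexBetti.map (snd ws_E ws_E).hom.hom.hom (1 + 1) ws_ω := by
  rw [ws_map_ω, ws_map_ω, ws_map_ω, ws_map_ω]
  simp only [map_add, map_zsmul, ← Int.cast_smul_eq_zsmul ℂ, LinearMap.add_apply]
  simp only [map_smul, LinearMap.smul_apply]
  module

/-- `T(pr₁^*ω) = (1+p)·pr₁^*ω - p·μ^*ω + (p² + p)·pr₂^*ω` for `T = (𝟙 + ψ)^*`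
(`(𝟙+ψ) ≫ pr₁ = pr₁ - p·pr₂`). [cite: vanGeemen1994HodgeAV, Lemma 5.2] -/
theorem sb_T_ΩF (p : ℕ) :
    complexBetti.map (𝟙 ws_B + ws_ψ p).hom.hom.hom (1 + 1)
        (complexBetti.map (fst ws_E ws_E).hom.hom.hom (1 + 1) ws_ω) =
      (1 + (p : ℂ)) • complexBetti.map (fst ws_E ws_E).hom.hom.hom (1 + 1) ws_ω -
        (p : ℂ) • complexBetti.map (fst ws_E ws_E + snd ws_E ws_E).hom.hom.hom (1 + 1) ws_ω +
        ((p : ℂ) ^ 2 + p) • complexBetti.map (snd ws_E ws_E).hom.hom.hom (1 + 1) ws_ω := by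
  rw [ws_map_map, ws_g_fst]
  have h := sb_Ω_lin 1 (-(p : ℤ))
  rw [one_smul, neg_smul, ← sub_eq_add_neg] at h
  rw [h]
  simp only [Int.cast_one, one_pow, Int.cast_neg, Int.cast_natCast, mul_neg, one_mul, neg_smul, even_two,
    Even.neg_pow, sub_neg_eq_add, ← sub_eq_add_neg]

/-- `T(pr₂^*ω) = μ^*ω` (`(𝟙+ψ) ≫ pr₂ = pr₂ + pr₁ = μ`). [cite: vanGeemen1994HodgeAV, Lemma 5.2] -/
theorem sb_T_ΩS (p : ℕ) :
    complexBetti.map (𝟙 ws_B + ws_ψ p).hom.hom.hom (1 + 1)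
        (complexBetti.map (snd ws_E ws_E).hom.hom.hom (1 + 1) ws_ω) =
      complexBetti.map (fst ws_E ws_E + snd ws_E ws_E).hom.hom.hom (1 + 1) ws_ω := by
  rw [ws_map_map, ws_g_snd, add_comm (snd ws_E ws_E)]

/-! ### `T` on the `(1,1)`-Künneth generators `pr₁^*b ⌣ pr₂^*w` -/

/-- `(f + f')^* = f^* + f'^*` on `H¹(E(ℂ); ℂ)`, pointwise. [cite: LangeBirkenhake1992, §1.1 (p. 19)] -/
theorem sb_map_add_one (f f' : ws_B ⟶ ws_E) (b : complexBetti ws_E.X 1) :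
    complexBetti.map (f + f').hom.hom.hom 1 b =
      complexBetti.map f.hom.hom.hom 1 b + complexBetti.map f'.hom.hom.hom 1 b := by
  rw [complexBetti_map_add_one]; rfl

/-- `T(pr₁^*b) = pr₁^*b - p·pr₂^*b` on `H¹`. [cite: vanGeemen1994HodgeAV, Lemma 5.2] -/
theorem sb_T_F_one (p : ℕ) (b : complexBetti ws_E.X 1) :
    complexBetti.map (𝟙 ws_B + ws_ψ p).hom.hom.hom 1 (complexBetti.map (fst ws_E ws_E).hom.hom.hom 1 b) =
      complexBetti.map (fst ws_E ws_E).hom.hom.hom 1 b -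
        (p : ℂ) • complexBetti.map (snd ws_E ws_E).hom.hom.hom 1 b := by
  rw [ws_map_map, ws_g_fst, complexBetti_map_sub_one, complexBetti_map_zsmul_one]
  change ((complexBetti.map (fst ws_E ws_E).hom.hom.hom 1 -
    (p : ℤ) • complexBetti.map (snd ws_E ws_E).hom.hom.hom 1).hom) b = _
  rw [ModuleCat.hom_sub, ModuleCat.hom_zsmul, LinearMap.sub_apply, LinearMap.smul_apply,
    ← Int.cast_smul_eq_zsmul ℂ, Int.cast_natCast]

/-- `T(pr₂^*w) = pr₂^*w + pr₁^*w` on `H¹`. [cite: vanGeemen1994HodgeAV, Lemma 5.2] -/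
theorem sb_T_S_one (p : ℕ) (w : complexBetti ws_E.X 1) :
    complexBetti.map (𝟙 ws_B + ws_ψ p).hom.hom.hom 1 (complexBetti.map (snd ws_E ws_E).hom.hom.hom 1 w) =
      complexBetti.map (snd ws_E ws_E).hom.hom.hom 1 w +
        complexBetti.map (fst ws_E ws_E).hom.hom.hom 1 w := by
  rw [ws_map_map, ws_g_snd, sb_map_add_one]

/-- **`L(pr₁^*b ⌣ pr₂^*w) = (1+p)β·pr₁^*ω - pβ·μ^*ω`** for `L = T - (1+p)` and `b ⌣ w = β·ω` (the
`(1,1)`-Künneth generators of `H²(B)`; basis-free: `f^*b ⌣ f^*w = β·f^*ω` for `f = pr₁, pr₂, μ`), hence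
`L` maps them into any subspace `Q ∋ pr₁^*ω, μ^*ω`. [cite: vanGeemen1994HodgeAV, Lemma 5.2] -/
theorem sb_L_cross (p : ℕ) {Q : Submodule ℂ (complexBetti ws_B.X (1 + 1))}
    (hF : complexBetti.map (fst ws_E ws_E).hom.hom.hom (1 + 1) ws_ω ∈ Q)
    (hμ : complexBetti.map (fst ws_E ws_E + snd ws_E ws_E).hom.hom.hom (1 + 1) ws_ω ∈ Q)
    (b w : complexBetti ws_E.X 1) :
    complexBetti.map (𝟙 ws_B + ws_ψ p).hom.hom.hom (1 + 1)
        (cupProduct rfl (complexBetti.map (fst ws_E ws_E).hom.hom.hom 1 b)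
          (complexBetti.map (snd ws_E ws_E).hom.hom.hom 1 w)) -
      (1 + (p : ℂ)) • cupProduct rfl (complexBetti.map (fst ws_E ws_E).hom.hom.hom 1 b)
          (complexBetti.map (snd ws_E ws_E).hom.hom.hom 1 w) ∈ Q := by
  obtain ⟨β, hβ⟩ := sb_E_two (cupProduct rfl b w)
  have hsq : ∀ f : ws_B ⟶ ws_E, cupProduct rfl (complexBetti.map f.hom.hom.hom 1 b)
      (complexBetti.map f.hom.hom.hom 1 w) = β • complexBetti.map f.hom.hom.hom (1 + 1) ws_ω := fun f => by
    rw [← cupProduct_map, hβ, map_smul]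
  have hFS := hsq (fst ws_E ws_E + snd ws_E ws_E)
  rw [sb_map_add_one, sb_map_add_one, map_add, map_add, LinearMap.add_apply, LinearMap.add_apply,
    hsq, hsq] at hFS
  rw [cupProduct_map, sb_T_F_one, sb_T_S_one, map_sub, map_smul, LinearMap.sub_apply, LinearMap.smul_apply,
    map_add, map_add, hsq, hsq]
  have key : cupProduct rfl (complexBetti.map (fst ws_E ws_E).hom.hom.hom 1 b)
        (complexBetti.map (snd ws_E ws_E).hom.hom.hom 1 w) +
      β • complexBetti.map (fst ws_E ws_E).hom.hom.hom (1 + 1) ws_ω -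
      (p : ℂ) • (β • complexBetti.map (snd ws_E ws_E).hom.hom.hom (1 + 1) ws_ω +
        cupProduct rfl (complexBetti.map (snd ws_E ws_E).hom.hom.hom 1 b)
          (complexBetti.map (fst ws_E ws_E).hom.hom.hom 1 w)) -
      (1 + (p : ℂ)) • cupProduct rfl (complexBetti.map (fst ws_E ws_E).hom.hom.hom 1 b)
          (complexBetti.map (snd ws_E ws_E).hom.hom.hom 1 w) =
      ((1 + (p : ℂ)) * β) • complexBetti.map (fst ws_E ws_E).hom.hom.hom (1 + 1) ws_ω -
        ((p : ℂ) * β) • complexBetti.map (fst ws_E ws_E + snd ws_E ws_E).hom.hom.hom (1 + 1) ws_ω := by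
    linear_combination (norm := module) (-(p : ℂ)) • hFS
  rw [key]
  exact Q.sub_mem (Q.smul_mem _ hF) (Q.smul_mem _ hμ)

/-! ### `L = T - (1 + p)` maps `H²(B(ℂ); ℂ)` into any `Q ∋ pr₁^*ω, pr₂^*ω, μ^*ω` (Künneth) -/

/-- Generators `pr₁^*b ⌣ pr₂^*w`, `b ∈ H⁰`, `w ∈ H²`: multiples of `pr₂^*ω`, and `L(pr₂^*ω) = μ^*ω - (1+p)·pr₂^*ω`.
[cite: vanGeemen1994HodgeAV, Lemma 5.2] -/
theorem sb_L_gen_left (p : ℕ) {Q : Submodule ℂ (complexBetti ws_B.X (1 + 1))}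
    (hS : complexBetti.map (snd ws_E ws_E).hom.hom.hom (1 + 1) ws_ω ∈ Q)
    (hμ : complexBetti.map (fst ws_E ws_E + snd ws_E ws_E).hom.hom.hom (1 + 1) ws_ω ∈ Q)
    (b : complexBetti ws_E.X 0) (w : complexBetti ws_E.X (1 + 1)) :
    complexBetti.map (𝟙 ws_B + ws_ψ p).hom.hom.hom (1 + 1)
        (cupProduct (Nat.zero_add (1 + 1)) (complexBetti.map (fst ws_E ws_E).hom.hom.hom 0 b)
          (complexBetti.map (snd ws_E ws_E).hom.hom.hom (1 + 1) w)) -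
      (1 + (p : ℂ)) • cupProduct (Nat.zero_add (1 + 1)) (complexBetti.map (fst ws_E ws_E).hom.hom.hom 0 b)
          (complexBetti.map (snd ws_E ws_E).hom.hom.hom (1 + 1) w) ∈ Q := by
  obtain ⟨r, rfl⟩ := sb_E_zero b
  obtain ⟨s, rfl⟩ := sb_E_two w
  simp only [map_smul, LinearMap.smul_apply, singularCohomology.map_one]
  rw [one_cupProduct, sb_T_ΩS, show s • r • complexBetti.map (fst ws_E ws_E + snd ws_E ws_E).hom.hom.hom (1 + 1) ws_ω
      - (1 + (p : ℂ)) • s • r • complexBetti.map (snd ws_E ws_E).hom.hom.hom (1 + 1) ws_ω =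
      (s * r) • complexBetti.map (fst ws_E ws_E + snd ws_E ws_E).hom.hom.hom (1 + 1) ws_ω -
      (s * r * (1 + p)) • complexBetti.map (snd ws_E ws_E).hom.hom.hom (1 + 1) ws_ω by module]
  exact Q.sub_mem (Q.smul_mem _ hμ) (Q.smul_mem _ hS)

/-- Generators `pr₁^*b ⌣ pr₂^*w`, `b ∈ H²`, `w ∈ H⁰`: multiples of `pr₁^*ω`, and
`L(pr₁^*ω) = -p·μ^*ω + (p² + p)·pr₂^*ω`. [cite: vanGeemen1994HodgeAV, Lemma 5.2] -/
theorem sb_L_gen_right (p : ℕ) {Q : Submodule ℂ (complexBetti ws_B.X (1 + 1))}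
    (hS : complexBetti.map (snd ws_E ws_E).hom.hom.hom (1 + 1) ws_ω ∈ Q)
    (hμ : complexBetti.map (fst ws_E ws_E + snd ws_E ws_E).hom.hom.hom (1 + 1) ws_ω ∈ Q)
    (b : complexBetti ws_E.X (1 + 1)) (w : complexBetti ws_E.X 0) :
    complexBetti.map (𝟙 ws_B + ws_ψ p).hom.hom.hom (1 + 1)
        (cupProduct (Nat.add_zero (1 + 1)) (complexBetti.map (fst ws_E ws_E).hom.hom.hom (1 + 1) b)
          (complexBetti.map (snd ws_E ws_E).hom.hom.hom 0 w)) -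
      (1 + (p : ℂ)) • cupProduct (Nat.add_zero (1 + 1)) (complexBetti.map (fst ws_E ws_E).hom.hom.hom (1 + 1) b)
          (complexBetti.map (snd ws_E ws_E).hom.hom.hom 0 w) ∈ Q := by
  obtain ⟨r, rfl⟩ := sb_E_two b
  obtain ⟨s, rfl⟩ := sb_E_zero w
  simp only [map_smul, LinearMap.smul_apply, singularCohomology.map_one]
  rw [cupProduct_one, sb_T_ΩF, show s • r • ((1 + (p : ℂ)) • complexBetti.map (fst ws_E ws_E).hom.hom.hom (1 + 1) ws_ω -
      (p : ℂ) • complexBetti.map (fst ws_E ws_E + snd ws_E ws_E).hom.hom.hom (1 + 1) ws_ω +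
      ((p : ℂ) ^ 2 + p) • complexBetti.map (snd ws_E ws_E).hom.hom.hom (1 + 1) ws_ω) -
      (1 + (p : ℂ)) • s • r • complexBetti.map (fst ws_E ws_E).hom.hom.hom (1 + 1) ws_ω =
      (-(s * r * p)) • complexBetti.map (fst ws_E ws_E + snd ws_E ws_E).hom.hom.hom (1 + 1) ws_ω +
      (s * r * (p ^ 2 + p)) • complexBetti.map (snd ws_E ws_E).hom.hom.hom (1 + 1) ws_ω by module]
  exact Q.add_mem (Q.smul_mem _ hμ) (Q.smul_mem _ hS)

/-- **`T c - (1+p)·c ∈ Q` for every `c ∈ H²(B(ℂ); ℂ)`** and every subspace `Q ∋ pr₁^*ω, pr₂^*ω, μ^*ω`: by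
Künneth (`kunnethSpan_complexBetti`) `H²(B)` is spanned by the cross products `pr₁^*b ⌣ pr₂^*w`,
`deg b + deg w = 2`, handled by `sb_L_gen_left`, `sb_L_cross`, `sb_L_gen_right`.
[cite: HatcherAT2002, §3.2 Thm. 3.15] -/
theorem sb_L_mem (p : ℕ) {Q : Submodule ℂ (complexBetti ws_B.X (1 + 1))}
    (hF : complexBetti.map (fst ws_E ws_E).hom.hom.hom (1 + 1) ws_ω ∈ Q)
    (hS : complexBetti.map (snd ws_E ws_E).hom.hom.hom (1 + 1) ws_ω ∈ Q)
    (hμ : complexBetti.map (fst ws_E ws_E + snd ws_E ws_E).hom.hom.hom (1 + 1) ws_ω ∈ Q)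
    (c : complexBetti ws_B.X (1 + 1)) :
    complexBetti.map (𝟙 ws_B + ws_ψ p).hom.hom.hom (1 + 1) c - (1 + (p : ℂ)) • c ∈ Q := by
  let L : complexBetti ws_B.X (1 + 1) →ₗ[ℂ] complexBetti ws_B.X (1 + 1) :=
    (complexBetti.map (𝟙 ws_B + ws_ψ p).hom.hom.hom (1 + 1)).hom - (1 + (p : ℂ)) • LinearMap.id
  change c ∈ Q.comap L
  refine Submodule.span_le.mpr ?_
    (kunnethSpan_complexBetti ws_isSmoothProjective_E ws_isSmoothProjective_E (1 + 1) c)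
  rintro _ ⟨i, j, h, b, w, rfl⟩
  change complexBetti.map (𝟙 ws_B + ws_ψ p).hom.hom.hom (1 + 1)
      (cupProduct h (complexBetti.map (fst ws_E ws_E).hom.hom.hom i b)
        (complexBetti.map (snd ws_E ws_E).hom.hom.hom j w)) -
    (1 + (p : ℂ)) • cupProduct h (complexBetti.map (fst ws_E ws_E).hom.hom.hom i b)
        (complexBetti.map (snd ws_E ws_E).hom.hom.hom j w) ∈ Q
  obtain rfl | rfl | rfl : i = 0 ∨ i = 1 ∨ i = 2 := by omega
  · obtain rfl : j = 2 := by omega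
    exact sb_L_gen_left p hS hμ b w
  · obtain rfl : j = 1 := by omega
    exact sb_L_cross p hF hμ b w
  · obtain rfl : j = 0 := by omega
    exact sb_L_gen_right p hS hμ b w

/-- On an eigenspace of `T` for an eigenvalue `λ ≠ 1 + p`, `L = (λ - 1 - p)·id`, so the eigenspace lies in
every `Q ∋ pr₁^*ω, pr₂^*ω, μ^*ω`. [cite: vanGeemen1994HodgeAV, Lemma 5.2] -/
theorem sb_eigenspace_le (p : ℕ) {Q : Submodule ℂ (complexBetti ws_B.X (1 + 1))}
    (hF : complexBetti.map (fst ws_E ws_E).hom.hom.hom (1 + 1) ws_ω ∈ Q)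
    (hS : complexBetti.map (snd ws_E ws_E).hom.hom.hom (1 + 1) ws_ω ∈ Q)
    (hμ : complexBetti.map (fst ws_E ws_E + snd ws_E ws_E).hom.hom.hom (1 + 1) ws_ω ∈ Q)
    {μ : ℂ} (hne : μ - (1 + (p : ℂ)) ≠ 0) :
    Module.End.eigenspace (complexBetti.map (𝟙 ws_B + ws_ψ p).hom.hom.hom (2 * 1)).hom μ ≤ Q := by
  intro c hc
  have h : (complexBetti.map (𝟙 ws_B + ws_ψ p).hom.hom.hom (2 * 1)).hom c - (1 + (p : ℂ)) • c ∈ Q :=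
    sb_L_mem p hF hS hμ c
  rw [Module.End.mem_eigenspace_iff.mp hc, ← sub_smul] at h
  exact (Submodule.smul_mem_iff _ hne).mp h

/-! ### `pr₁^*ω`, `pr₂^*ω`, `μ^*ω` are divisor classes; assembly -/

/-- A homomorphism with a section is onto on the underlying spaces. [folklore] -/
theorem sb_surjective_of_section (f : ws_B ⟶ ws_E) (s : ws_E ⟶ ws_B) (h : s ≫ f = 𝟙 ws_E) :
    Function.Surjective f.hom.hom.hom.left.base := fun y =>
  ⟨s.hom.hom.hom.left.base y, congrArg (fun g : ws_E ⟶ ws_E => g.hom.hom.hom.left.base y) h⟩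

/-- **`f^*ω ∈ N¹H²(B(ℂ); ℂ)`** for a homomorphism `f : B → E` with a section: every class in `H²` of the
CURVE `E` is algebraic (`algebraicClasses_eq_top_of_eq_zero_or_le`, the class of a point), and `N¹` pulls
back along surjections (`map_mem_algebraicClasses_one_of_surjective`). [cite: GrothendieckTopology1969, §1] -/
theorem sb_Ω_mem (f : ws_B ⟶ ws_E) (s : ws_E ⟶ ws_B) (h : s ≫ f = 𝟙 ws_E) :
    complexBetti.map f.hom.hom.hom (1 + 1) ws_ω ∈ algebraicClasses ws_B.X 1 := by
  have hω : ws_ω ∈ algebraicClasses ws_E.X 1 := by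
    rw [algebraicClasses_eq_top_of_eq_zero_or_le ws_isSmoothProjective_E (p := 1) (Or.inr le_rfl)]
    exact Submodule.mem_top
  exact map_mem_algebraicClasses_one_of_surjective ws_isSmoothProjective_B ws_isSmoothProjective_E
    f.hom.hom.hom (sb_surjective_of_section f s h) hω

/-- `((1+i√p)² - (1+p)) · ((1-i√p)² - (1+p)) = 4p(p+1)`. [folklore] -/
theorem sb_eigen_prod (p : ℕ) :
    ((1 + Complex.I * (Real.sqrt (p : ℝ) : ℂ)) ^ (2 * 1) - (1 + (p : ℂ))) *
      ((1 - Complex.I * (Real.sqrt (p : ℝ) : ℂ)) ^ (2 * 1) - (1 + (p : ℂ))) = 4 * (p : ℂ) * ((p : ℂ) + 1) := by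
  linear_combination (Complex.I ^ 4 * (((Real.sqrt (p : ℝ) : ℝ) : ℂ) ^ 2 + (p : ℂ)) - 2 * (p : ℂ) * Complex.I ^ 2 -
    4 * Complex.I ^ 2) * ws_sqrt_sq p + ((p : ℂ) ^ 2 * (Complex.I ^ 2 - 1) - 2 * (p : ℂ) ^ 2 - 4 * (p : ℂ)) * Complex.I_sq

/-- **The typed Weil plane `Eig(T, (1+i√p)²) ⊔ Eig(T, (1-i√p)²)` of the companion surface consists of
divisor classes** (`p > 0`): take `Q = N¹H²(B)`, which contains `pr₁^*ω`, `pr₂^*ω`, `μ^*ω` (sections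
`(𝟙, 0)`, `(0, 𝟙)`, `(𝟙, 0)`). [cite: vanGeemen1994HodgeAV, Lemma 5.2] -/
theorem sb_typedWeilPlane_le {p : ℕ} (hp : 0 < p) :
    Module.End.eigenspace (complexBetti.map (𝟙 ws_B + ws_ψ p).hom.hom.hom (2 * 1)).hom
          ((1 + Complex.I * (Real.sqrt (p : ℝ) : ℂ)) ^ (2 * 1)) ⊔
        Module.End.eigenspace (complexBetti.map (𝟙 ws_B + ws_ψ p).hom.hom.hom (2 * 1)).hom
          ((1 - Complex.I * (Real.sqrt (p : ℝ) : ℂ)) ^ (2 * 1)) ≤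
      algebraicClasses ws_B.X 1 := by
  have hF := sb_Ω_mem (fst ws_E ws_E) (prodLift (𝟙 ws_E) 0) (prodLift_fst _ _)
  have hS := sb_Ω_mem (snd ws_E ws_E) (prodLift 0 (𝟙 ws_E)) (prodLift_snd _ _)
  have hμ := sb_Ω_mem (fst ws_E ws_E + snd ws_E ws_E) (prodLift (𝟙 ws_E) 0)
    (by rw [Preadditive.comp_add, prodLift_fst, prodLift_snd, add_zero])
  have hne : ((1 + Complex.I * (Real.sqrt (p : ℝ) : ℂ)) ^ (2 * 1) - (1 + (p : ℂ))) *
      ((1 - Complex.I * (Real.sqrt (p : ℝ) : ℂ)) ^ (2 * 1) - (1 + (p : ℂ))) ≠ 0 := by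
    rw [sb_eigen_prod]
    exact_mod_cast (show 4 * p * (p + 1) ≠ 0 by positivity)
  obtain ⟨h₁, h₂⟩ := mul_ne_zero_iff.mp hne
  exact sup_le (sb_eigenspace_le p hF hS hμ h₁) (sb_eigenspace_le p hF hS hμ h₂)

/-- **The strong Weil plane `weilClassesOf B ψ 1 p` of the companion surface `(E × E, ψ)` consists of
divisor classes** (`p > 0`): `E± ⊆ Eig((𝟙+ψ)^*, (1 ± i√p)²)` (test endomorphism `x = y = 1`).
[cite: vanGeemen1994HodgeAV, Lemma 5.2 and 4.9] -/
theorem sb_weilClassesOf_le {p : ℕ} (hp : 0 < p) :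
    weilClassesOf ws_B (ws_ψ p) 1 p ≤ algebraicClasses ws_B.X 1 := by
  refine le_trans (sup_le_sup ?_ ?_) (sb_typedWeilPlane_le hp)
  · intro c hc
    have h := (mem_weilClassesPlus_iff.mp hc) 1 1
    simp only [one_nsmul, Nat.cast_one, one_mul] at h
    exact Module.End.mem_eigenspace_iff.mpr h
  · intro c hc
    have h := (mem_weilClassesMinus_iff.mp hc) 1 1
    simp only [one_nsmul, Nat.cast_one, one_mul] at h
    exact Module.End.mem_eigenspace_iff.mpr h

/-- **Stub A0 (`stub_surfaceBase`) for THE companion surface of the line** (`B = E × E`,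
`E = ℂ/(ℤ + iℤ)`, `ψ` the companion of `T² + p`, as produced by `stub_weilSurface`): its strong Weil plane
consists of algebraic classes. [cite: vanGeemen1994HodgeAV, Lemma 5.2] -/
theorem stub_surfaceBase_companion :
    ∀ p : ℕ, p.Prime → p % 4 = 3 → 7 ≤ p →
      weilClassesOf ws_B (ws_ψ p) 1 p ≤ algebraicClasses ws_B.X 1 :=
  fun _ _ _ hp7 => sb_weilClassesOf_le (by omega)

/-- **`stub_weilSurface` and A0 merged**: for `p` prime, `p ≡ 3 (4)`, `p ≥ 7` there is a complex abelian
surface `B` with `ψ ≫ ψ = -p·𝟙`, a non-zero rational `(1,1)` class in the typed Weil plane, AND algebraic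
strong Weil plane `weilClassesOf B ψ 1 p` — the companion surface. [cite: vanGeemen1994HodgeAV, Lemma 5.2] -/
theorem sb_weilSurface_with_base :
    ∀ p : ℕ, p.Prime → p % 4 = 3 → 7 ≤ p → ∃ (B : AbelianVariety ℂ) (ψ : B ⟶ B),
      B.dim = 2 ∧ ψ ≫ ψ = -((p : ℤ) • 𝟙 B) ∧
        (∃ b : complexBetti B.X (2 * 1), b ≠ 0 ∧ IsRationalClass b ∧
          IsOfHodgeType (2 * 1) B.X (2 * 1) 1 1 b ∧
          b ∈ Module.End.eigenspace (complexBetti.map (𝟙 B + ψ).hom.hom.hom (2 * 1)).hom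
                ((1 + Complex.I * (Real.sqrt (p : ℝ) : ℂ)) ^ (2 * 1)) ⊔
              Module.End.eigenspace (complexBetti.map (𝟙 B + ψ).hom.hom.hom (2 * 1)).hom
                ((1 - Complex.I * (Real.sqrt (p : ℝ) : ℂ)) ^ (2 * 1))) ∧
        weilClassesOf B ψ 1 p ≤ algebraicClasses B.X 1 := by
  intro p _ _ hp7
  exact ⟨ws_B, ws_ψ p, ws_dim_B, ws_ψ_comp_ψ p, ⟨ws_b p, ws_b_ne_zero p, ws_b_rational p, ws_b_hodge p,
    ws_mem_sup_eigenspace _ (ws_eigen_ne (by omega)) (by rw [ws_eigen_add, ws_eigen_mul]; exact ws_key p)⟩,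
    sb_weilClassesOf_le (by omega)⟩

end Summit.HodgeConjecture.HodgeConjecture.Theorems.HeckePrymWeilLine

end
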